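import Summits.BirchSwinnertonDyer.BirchSwinnertonDyer.Theorems.ErratumRoadFiveKatoFframeKummerUnramifiedBadD
import Summits.BirchSwinnertonDyer.BirchSwinnertonDyer.Theorems.ErratumRoadFiveKatoFframeS1LambdaOfAllBadAdditive
import HarnessLib

/-!
# Route `ErratumRoadFive`, crux `EulerHalfNotRamNoInertSetAtFive` (stmt-BirchSwinnertonDyer-19715), line `kato_Fframe`
# (registered r5.4 3e8aa5467f42b525), stub S1Λ `stub_katoLambdaLogBoundTamagawa` — **S1Λ PROVED FOR THE WHOLE CLASS**
# (bad primes `ℓ ≠ p` of ANY reduction type), modulo the three named facts of the cite stub S0 (GZK, F1′, H2Xʳ) that the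
# r5.4 signature takes as leading hypotheses: the r5.4 body of S1Λ VERBATIM (`bottomClass`/`logOmega` unfolded)

LEAD seat `bsd-line-er5-p1` (g9), `--supports stmt-BirchSwinnertonDyer-19715`; theorems only (no definition, no named fact, no
instance, no notation, no `sorry`). HONEST FRAMING: S1Λ is proved here from the three S0 facts taken BY NAME as hypotheses (exactly as the
registered r5.4 stub states it); the crux 19715 is NOT closed (S0 is a cite stub by design; S3 `stub_integralExcZeroValue` / S3ns
`stub_integralNonsplitValue` are open research doors); no summit statement is proved; BSD is proved for no curve.

## What changed since the sub-class closer `…S1LambdaOfAllBadAdditive` (p764175, LEAD g8)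

That file proved the r5.4 body with ONE extra hypothesis `hadd` «every bad `ℓ ≠ p` additive», consumed at exactly one place: the
(R1-d) package of cell bsd-cm's Part 30 (`KummerUnramified.exists_relIndex_selmerGroup_eq_pow_and_mul_eq`), whose additivity entered
through the local index, the door and the exponent at the places of `Σ`.  The LEAD's R-C files discharge all three at EVERY finite
`ℓ ∤ p` (`ErratumRoadFiveKatoFframeLocalIndex`, `…LocalLift`, `…LocalLiftFixedPoints`, `…LocalIndexCount`) and re-thread Parts 24 §3 /
25 / 26 / 27 / 29 / 30 (`…KummerUnramifiedBadA–D`): `KummerUnramifiedBad.exists_relIndex_selmerGroup_eq_pow_and_mul_eq_of_ne` is Part 30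
WITHOUT `hQadd`.  THIS FILE = p764175's chain with `Σ :=` the bad places `≠ v_p` (any type) and R-D §1
(`ErratumRoadFiveKatoFframeStrictSelmerCountMult.finite_katoStrictSelmer_and_padicValNat_card_eq_of_mult_of_relIndex`) fed by it.

* **`katoLambdaLogBoundTamagawa (hGZK) (hF1) (hH2X)`** — the registered r5.4 signature of `stub_katoLambdaLogBoundTamagawa` after its
  three fact-hypotheses, token-for-token (the skeleton's `bottomClass W p K I z₀ = layerZeroToTop W p K (I.proj 0 z₀)` and
  `logOmega W p x = padicLogLocal W p (Affine.Point.map (Algebra.ofId ℚ ℚ_[p]) x)` unfolded, as in p764175).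

References: [Kato2004Asterisque] Thm. 12.4 (3), Thm. 12.5 (4) (pp. 221–222), §14.1 (p. 235), §14.8 (p. 238), (14.9.3) (p. 240), §14.14
(pp. 243–244), Prop. 14.16, 14.18 (p. 244); [GreenbergLNM1716] §2–§5 (Lemma 3.3 p. 87, p. 74, p. 88, p. 114); [Rubin2000] Thm. 1.7.3;
[MilneADT2006] Ch. I 2.9, 3.3, 3.8, 4.10; [SilvermanAEC2009] IV.6.4, VII.§2, VII.3.1, VII.6, VIII.§2, X.§4; [Darmon2004] Thm. 3.22.
-/

-- the summit and its single problem are both named `BirchSwinnertonDyer` (registry layout D-0017)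
set_option linter.dupNamespace false
set_option autoImplicit false

noncomputable section

open scoped Classical NumberField
open Field IsDedekindDomain WeierstrassCurve NumberField
open Literature.NumberTheory.EllipticCurves Literature.NumberTheory.EllipticCurves.Kato2004
open Literature.NumberTheory.EllipticCurves.Kato2004.EulerSystemValues
open Literature.NumberTheory.EllipticCurves.IwasawaAlgebra
open Literature.NumberTheory.EllipticCurves.Rank1Residual
open Literature.NumberTheory.GaloisRepresentations
open Summit.BirchSwinnertonDyer.Rank1Residual
open Summit.BirchSwinnertonDyer.Rank1Residual.Additive
open Summit.BirchSwinnertonDyer.BirchSwinnertonDyer.Theorems.ErratumRoadFiveKatoFframeS1LambdaOfAllBadAdditive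

namespace Summit.BirchSwinnertonDyer.BirchSwinnertonDyer.Theorems.ErratumRoadFiveKatoFframeS1Lambda

/-- **S1Λ (`stub_katoLambdaLogBoundTamagawa`, r5.4 signature) FOR THE WHOLE CLASS** — modulo the three named facts GZK, F1′ (Kato Thm. 12.5
(4), fine form) and H2Xʳ (Kato (14.9.3) + (14.14.2)) taken as hypotheses, exactly as registered: for `p ≥ 5`, `ρ̄_{W,p}` onto,
`r_an(W) = 1`, `p` multiplicative (split or non-split; the other bad primes of ANY type), a Mordell–Weil basis `P`, the cyclotomic `(K, γ)`,
a pinned `𝐇¹_Γ(T_pW)` with an ADMISSIBLE `z₀` whose bottom layer has Kummer logarithm `t ≠ 0`, every `m`, every local `Q₀` of order `p^m` and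
every local `Q` with `log_ω Q ≠ 0`:
`ord_p #Ш + ord_p log_ω x̂ − ord_p log_ω Q + ((ord_p ∏c_ℓ − ord_p c_p) + m) ≤ ord_p t − ord_p log_ω x̂`, `x̂ = P 0`.
Chain: GZK ⟹ `Ш` finite; `Surj` ⟹ `p ∤ #W(ℚ)_tors` ⟹ `#W(ℚ)[p^∞] = 1`; (12.5.2); R-fin; F1′; H2Xʳ; `κ_∞(x̂)`, `a`; L3′; (R1-d) for
`Σ` = bad `ℓ ≠ p` of ANY type (`KummerUnramifiedBad.exists_relIndex_selmerGroup_eq_pow_and_mul_eq_of_ne`); R-D §1; ASSEMBLY.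
[cite: Kato2004Asterisque, Thm. 12.4 (3), Thm. 12.5 (4) (pp. 221–222), (14.9.3) (p. 240), §14.14 (pp. 243–244)]
[cite: GreenbergLNM1716, §3 Lemma 3.3 and p. 88, §4 Lemma 4.2] [cite: Darmon2004, Thm. 3.22] -/
theorem katoLambdaLogBoundTamagawa
    (hGZK : rank_eq_analyticRank_of_analyticRank_le_one)
    (hF1 : lengthAt_fineSelmerDual_le_of_isAdmissibleZetaClass)
    (hH2X : exists_iwasawaH2Data_fineSelmerDual_embedding_countRankFree) :
    ∀ (W : WeierstrassCurve ℚ) [W.IsElliptic] [W.IsGloballyMinimal] (p : ℕ) [Fact p.Prime]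
      [ContinuousSMul ℤ_[p] (W.tateModule p)],
      5 ≤ p → Surj W p → W.analyticRank = 1 → W.HasMultiplicativeReductionAtPrime p →
      ∀ (h1 : W.mordellWeilRank = 1) (P : Fin W.mordellWeilRank → W.toAffine.Point),
        W.IsMordellWeilBasis P →
      ∀ (K : ZpExtension ℚ p) (hK : K.IsCyclotomic) (γ : absoluteGaloisGroup ℚ)
        (I : IwasawaH1Data W p K γ) (z₀ : I.H), K.IsTopGenerator γ → IsAdmissibleZetaClass W p K hK I z₀ →
      ∀ t : ℚ_[p], HasLocPKummerLog W p (layerZeroToTop W p K (I.proj 0 z₀)) t → t ≠ 0 →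
      ∀ (m : ℕ) (Q₀ : (W.baseChange ℚ_[p]).toAffine.Point), addOrderOf Q₀ = p ^ m →
      ∀ Q : (W.baseChange ℚ_[p]).toAffine.Point, padicLogLocal W p Q ≠ 0 →
        (padicValNat p W.shaOrder : ℤ) +
              (padicLogLocal W p (WeierstrassCurve.Affine.Point.map (Algebra.ofId ℚ ℚ_[p]) (P (Fin.cast h1.symm 0)))).valuation
            - (padicLogLocal W p Q).valuation
            + (((padicValNat p W.tamagawaProduct : ℤ)
                - padicValNat p ((W.baseChange ℚ_[p]).localTamagawaNumber ℤ_[p])) + m) ≤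
          t.valuation -
            (padicLogLocal W p (WeierstrassCurve.Affine.Point.map (Algebra.ofId ℚ ℚ_[p]) (P (Fin.cast h1.symm 0)))).valuation := by
  intro W _ _ p _ _ h5 hsurj hr1 hmult h1 P hP K hK γ I z₀ hγ hz t ht ht0
  have hpP : p.Prime := Fact.out
  have hp2 : p ≠ 2 := by omega
  have hp3 : 3 ≤ p := by omega
  -- GZK: `Ш(W)` is finite
  have hshafin : Finite W.sha := (hGZK W (le_of_eq hr1)).2
  haveI := hshafin
  have hsha : Finite (AddCommGroup.primaryComponent W.sha p) := inferInstance
  -- `ρ̄` onto ⟹ `p ∤ #W(ℚ)_tors` ⟹ `#W(ℚ)[p^∞] = 1`; and (12.5.2)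
  have htors : ¬ p ∣ W.torsionOrder := not_dvd_torsionOrder_of_surj p W hsurj
  have hW1 : Nat.card (AddCommGroup.primaryComponent W.toAffine.Point p) = 1 := by
    convert StrictCount.natCard_primaryComponent_point_eq_one_of_not_dvd_torsionOrder W p htors
  have hSL : ImageContainsSL2 W p := imageContainsSL2_of_surj_of_five_le_or_semistable W p hp2 (Or.inl h5) hsurj
  -- R-fin: `W(ℚ_{p,∞})[p^∞]` is finite at the multiplicative `p`
  have hfin := ErratumRoadFiveKatoFframeLocalTowerTorsionFiniteMult.finite_fixedPoints_kerSubgroup_inf_decomp_of_multiplicative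
    W p hp3 hmult K hK (primePlace p) (coe_primesEquiv_primePlace p)
  -- F1′ at `z₀`
  have hlen := hF1 W p K γ hK hγ (primePlace p) hp2 hSL (coe_primesEquiv_primePlace p) hfin I z₀ hz
  -- H2Xʳ: the package `J ⊇ X₀` with its count
  obtain ⟨J, e, he, hcok, hcount⟩ :=
    hH2X.exists_count_of_finite_coinvariants (W := W) (p := p) (κ := K) (γ := γ) hγ (primePlace p) hp2 hK
      (coe_primesEquiv_primePlace p) hfin I
  -- the Mordell–Weil generator and its `T_p`-adic Kummer class
  have hgen : ∀ R : W.toAffine.Point, ∃ n : ℤ, IsOfFinAddOrder (R - n • P (Fin.cast h1.symm 0)) := fun R ↦ by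
    obtain ⟨n, hn⟩ := exists_sub_zsmul_isOfFinAddOrder_of_isMordellWeilBasis W h1 hP R
    exact ⟨n, by convert hn⟩
  obtain ⟨x, hx⟩ := GlobalKummer.exists_forall_ofTopSubgroup_reduceH1Pk_eq_kummerMapTorsion W p
    (GlobalKummer.zsmul_pow_surjective W p) (P (Fin.cast h1.symm 0))
  obtain ⟨a, ha, -⟩ := GlobalKummer.exists_integralH1_eq_span_pow_smul W p h1 hsha htors hgen hx
  -- L3′: the A-line index
  have hindex := ErratumRoadFiveKatoFframeALineIndex.padicValNat_card_quotient_span_proj_le W p K γ h1 hsha htors hgen hx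
    ha I z₀ ht ht0
  -- `Σ` := the bad places `≠ v_p`, of ANY reduction type; `T := Σ ∪ {v_p}`
  have hfinbad : (W.badPlaces (𝓞 ℚ)).Finite := WeierstrassCurve.finite_badPlaces_holds (A := 𝓞 ℚ) W
  set Qs : Finset (HeightOneSpectrum (𝓞 ℚ)) :=
    hfinbad.toFinset.filter (fun v => ((Rat.HeightOneSpectrum.primesEquiv v : Nat.Primes) : ℕ) ≠ p) with hQs
  have hQp : ∀ v ∈ Qs, ((Rat.HeightOneSpectrum.primesEquiv v : Nat.Primes) : ℕ) ≠ p := fun v hv =>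
    (Finset.mem_filter.mp hv).2
  have hQbad : ∀ v : HeightOneSpectrum (𝓞 ℚ), v ∈ W.badPlaces (𝓞 ℚ) →
      ((Rat.HeightOneSpectrum.primesEquiv v : Nat.Primes) : ℕ) ≠ p → v ∈ Qs := fun v hv hne =>
    Finset.mem_filter.mpr ⟨hfinbad.mem_toFinset.mpr hv, hne⟩
  have hTp : ∀ v : HeightOneSpectrum (𝓞 ℚ), ((p : ℕ) : 𝓞 ℚ) ∈ v.asIdeal → v ∈ insert (primePlace p) Qs := fun v hv =>
    Finset.mem_insert.mpr (Or.inl (BirchSwinnertonDyer.Theorems.KatoFiniteLevelCount.eq_primePlace_of_natCast_mem p hv))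
  have hTbad : ∀ v : HeightOneSpectrum (𝓞 ℚ), ¬ W.HasGoodReductionAt v → v ∈ insert (primePlace p) Qs := by
    intro v hv
    rw [Finset.mem_insert]
    by_cases hvp : v = primePlace p
    · exact Or.inl hvp
    · right
      refine hQbad v ((W.mem_badPlaces_iff v).mpr hv) fun h => hvp ?_
      apply (Rat.HeightOneSpectrum.primesEquiv (R := 𝓞 ℚ)).injective
      rw [primesEquiv_primePlace]
      exact Subtype.ext h
  -- (R1-d) at `Σ` of any reduction type (R-C): Part 30 without additivity
  obtain ⟨a₀, hA₀, S, hS, hle, hne, hprod, -⟩ :=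
    ErratumRoadFiveKatoFframeKummerUnramifiedBad.exists_relIndex_selmerGroup_eq_pow_and_mul_eq_of_ne W p hp2 h1 hsha htors hgen
      hx Qs (insert (primePlace p) Qs) (Finset.subset_insert _ _) hQp hQbad hTp hTbad
  have hPfin : ¬ IsOfFinAddOrder (P (Fin.cast h1.symm 0)) := ContraCount.not_isOfFinAddOrder_of_generates h1 hgen
  obtain rfl : a = a₀ := StrictCount.eq_of_integralH1_eq_span_pow_smul W p hPfin hx ha hA₀
  -- R-D §1: the strict Selmer count at the multiplicative `p`
  obtain ⟨-, hstrict⟩ :=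
    ErratumRoadFiveKatoFframeStrictSelmerCountMult.finite_katoStrictSelmer_and_padicValNat_card_eq_of_mult_of_relIndex W p hp2
      hmult h1 hsha hgen Qs hQp hQbad a S hS hle hne hprod
  -- assembly
  exact ErratumRoadFiveKatoFframeLambdaAssembly.katoLambdaLogBound_of_counts W p hmult h1 hshafin hW1
    (P (Fin.cast h1.symm 0)) K hK γ hγ I z₀ t ht ht0 hlen J e he hcok hcount a hindex hstrict

end Summit.BirchSwinnertonDyer.BirchSwinnertonDyer.Theorems.ErratumRoadFiveKatoFframeS1Lambda

end
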